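import Summits.QuantumFields.YangMills.Theorems.UV3BranchExpansionHaarBallSharp
import HarnessLib

/-!
# `UV3BranchExpansionHaarBallSharpRecord` — the window ratio and the element weight of hTop's count for EVERY block size `4 ≤ L ≤ 20` with the
# RECORD (H_K) constant: `h(8/21)^M/h(1/21) ≤ 10⁻²³` for `M ≥ 15` and `2·K_rec·q ≤ 10⁻¹⁴` (crux `UnitScaleTilt.HistoryTailL`, stmt-QuantumFields-19936 —
# SUPPLY side of hTop; count-neutral numerics; companion of ✓`UV3BranchExpansionHaarBallSharp` kept under the 400-line cap)

Cell `ym3-torus` (YM ladder rung R3 = continuum SU(2) Yang–Mills on T³ — a RUNG, NOT d = 4, NOT infinite volume, NOT a mass gap, NOT Clay);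
width seat `ym3-torus-px13` (gen 14), explicit-unit helper; `--supports stmt-QuantumFields-19936 --as helper`.  THEOREMS ONLY (0 `def`,
0 `sorry`, default heartbeats); imports ✓`UV3BranchExpansionHaarBallSharp` (this seat: the sharp ball bound `h(δ) ≤ 2π²δ³/81`, `haar_window_ratio_le`,
the `δ′ = 1/21` numerals `window_up_le`∕`window_low_ge`) and through it ✓`…GuardKStepMassesSU2Record.kstar_record_le` (`K_rec ≤ 3·10⁸`).

WHAT.  On the range `L^{d−1} ≤ 400` (every `L ≤ 20` at `d = 3`) the (H_K) supplier of the socket weight is ✓`fibre_law_le_su2_record` (w8 g12's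
✓`UV3BranchExpansionSocketWeightsSU.hw_su2_of_pow_le_four_hundred`), constant `K_rec = m⋆(1/400)⁻¹ + 1 ≤ 3·10⁸`.  For `L ≥ 4` the window exponent
`M = L^{d−1} − 1 ≥ 15` makes the ratio `q = h(1/3 + 1/21)^M / h(1/21) ≤ (339/25000)^{15}/(2289·10⁻⁸) ≤ 10⁻²³`, hence the element weight `x = 2·K_rec·q ≤ 10⁻¹⁴`
— the threshold of ✓∕⧗`UV3BranchExpansionCountingSmallnessT3.smallness_T3_allL_of_le` (v1.3: both smallness rows for every `4 ≤ L ≤ 20` at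
`(y, θ₀) = (9/10, (1 + (9/10)^{L−1})/2)`).  At `L = 3` the record constant does NOT close the count (px13 g14 FINDING, 19936 evidence #60 §4 (ii)); that
case is ✓`UV3BranchExpansionHaarBallSharp.two_mul_kstar_mul_ratio_le` with `K⋆` of ✓`fibre_law_le_su2`.
 ★★ `haar_window_ratio_le_numeral_of_le` (`15 ≤ M ⇒ h(8/21)^M/h(1/21) ≤ 10⁻²³`) · ★★ `two_mul_kstar_record_mul_ratio_le_of_le` (`≤ ofReal 10⁻¹⁴`) ·
 ★★ `two_mul_kstar_record_mul_ratio_le_letters` (the same in the exact letters of a `…HTopSegment`-type engine: `HaarData.haar` on `SU(2)`, exponent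
 `L ^ (3 − 1) − 1` with `L ≥ 4` SYMBOLIC).

HONEST FRAMING.  Count-neutral numerics by import; nothing of hTop ∕ (F-TOP) ∕ the χ record ∕ (O‴χₛ) ∕ `HistoryTailL` ∕ R3 is proved; N08 NOT discharged; the
Yang–Mills mass gap (Clay) is NOT proved.  0 `sorry`, 0 `def`, standard axioms.

References: T. Bałaban, CMP **102** (1985) 255–275 [Balaban1985UV3] p. 260 (the `SU(2)` Haar density); [Balaban1987RG1] (0.4) p. 253.
-/

noncomputable section

open MeasureTheory Metric Set
open scoped ENNReal

namespace Summit.QuantumFields.YangMills.Theorems.UV3BranchExpansionHaarBallSharpRecord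

open Literature.MathematicalPhysics.QuantumFieldTheory.Balaban1983to89
open Literature.MathematicalPhysics.QuantumFieldTheory (haarProbability)
open Literature.MathematicalPhysics.QuantumFieldTheory.Balaban1983to89.T4CubeChartGnomonic (SU2)
open Summit.QuantumFields.YangMills.BalabanUVNodes.N08HaarCompatibilityGuardHaarBall (haarData_haar_eq)
open Summit.QuantumFields.YangMills.BalabanUVNodes.N08HaarCompatibilityGuardKStepMassesSU2Record (kstar_record_le)
open Summit.QuantumFields.YangMills.Theorems.UV3BranchExpansionHaarBallSharp (haar_window_ratio_le window_up_le window_low_ge)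

/-! ## EVERY block size `4 ≤ L ≤ 20`: the RECORD constant and the window exponent `L² − 1 ≥ 15`

On the range `L^{d−1} ≤ 400` (every `L ≤ 20` at `d = 3`) the (H_K) supplier is ✓`fibre_law_le_su2_record` (w8's ✓`hw_su2_of_pow_le_four_hundred`) with
`K_rec ≤ 3·10⁸` (✓`kstar_record_le`); for `L ≥ 4` the window exponent `L² − 1 ≥ 15` makes `q ≤ (339/25000)^{15}/(2289·10⁻⁸) ≤ 10⁻²³`, so `2·K_rec·q ≤ 10⁻¹⁴` —
the threshold of `UV3BranchExpansionCountingSmallnessT3.smallness_T3_allL_of_le` (v1.3).  (At `L = 3` the record constant does NOT close the count — FINDING #60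
§4 (ii); that case is §3 with `K⋆`.) -/


/-- ★★ **THE WINDOW RATIO FOR EVERY EXPONENT `M ≥ 15` IS BELOW `10⁻²³`**: `h(8/21)^M / h(1/21) ≤ (339/25000)^{15}/(2289·10⁻⁸) ≤ 10⁻²³` (`339/25000 ≤ 1`).
[cite: Balaban1985UV3, p.260 (bookkeeping)] -/
theorem haar_window_ratio_le_numeral_of_le {M : ℕ} (hM : 15 ≤ M) :
    haarProbability SU2 {U : SU2 | dist1 U < 1 / 3 + 1 / 21} ^ M / haarProbability SU2 {U : SU2 | dist1 U < 1 / 21} ≤ (10 ^ 23 : ℝ≥0∞)⁻¹ := by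
  refine (haar_window_ratio_le (by norm_num) (by norm_num) M).trans ?_
  have hup0 : 0 ≤ 2 * Real.pi ^ 2 * (1 / 3 + 1 / 21 : ℝ) ^ 3 / 81 := by positivity
  have hnum : (2 * Real.pi ^ 2 * (1 / 3 + 1 / 21 : ℝ) ^ 3 / 81) ^ M ≤ (339 / 25000 : ℝ) ^ 15 :=
    (pow_le_pow_left₀ hup0 window_up_le M).trans (pow_le_pow_of_le_one (by norm_num) (by norm_num) hM)
  have hlowpos : (0 : ℝ) < 2289 / 100000000 := by norm_num
  have hratio : (2 * Real.pi ^ 2 * (1 / 3 + 1 / 21 : ℝ) ^ 3 / 81) ^ M / (2 / (3 * Real.pi) * ((1 - (1 / 21 : ℝ) ^ 2 / 6) ^ 2 * (1 / 21 : ℝ) ^ 3)) ≤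
      (339 / 25000 : ℝ) ^ 15 / (2289 / 100000000) :=
    div_le_div₀ (by positivity) hnum hlowpos window_low_ge
  have hfin : (339 / 25000 : ℝ) ^ 15 / (2289 / 100000000) ≤ 1 / 10 ^ 23 := by norm_num
  calc ENNReal.ofReal ((2 * Real.pi ^ 2 * (1 / 3 + 1 / 21 : ℝ) ^ 3 / 81) ^ M / (2 / (3 * Real.pi) * ((1 - (1 / 21 : ℝ) ^ 2 / 6) ^ 2 * (1 / 21 : ℝ) ^ 3)))
      ≤ ENNReal.ofReal (1 / 10 ^ 23 : ℝ) := ENNReal.ofReal_le_ofReal (hratio.trans hfin)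
    _ = (10 ^ 23 : ℝ≥0∞)⁻¹ := by
        rw [one_div, ENNReal.ofReal_inv_of_pos (by positivity)]
        norm_num

/-- ★★ **THE ELEMENT WEIGHT WITH THE RECORD CONSTANT IS BELOW `10⁻¹⁴` FOR EVERY WINDOW EXPONENT `M ≥ 15`** (`2·3·10⁸·10⁻²³ ≤ 10⁻¹⁴`).
[cite: Balaban1985UV3, p.260 (bookkeeping)] -/
theorem two_mul_kstar_record_mul_ratio_le_of_le {M : ℕ} (hM : 15 ≤ M) :
    2 * (((ENNReal.ofReal (((1 / 400 : ℝ) * Real.sin 1 * (Real.sin (Real.pi / 3) / (Real.pi / 3))) ^ 3 *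
        (Real.sin (Real.pi / 3) / (Real.pi / 3)) ^ 2))⁻¹ + 1 : ℝ≥0∞) *
        (haarProbability SU2 {U : SU2 | dist1 U < 1 / 3 + 1 / 21} ^ M / haarProbability SU2 {U : SU2 | dist1 U < 1 / 21})) ≤
      ENNReal.ofReal (1 / 10 ^ 14) := by
  calc 2 * (((ENNReal.ofReal (((1 / 400 : ℝ) * Real.sin 1 * (Real.sin (Real.pi / 3) / (Real.pi / 3))) ^ 3 *
        (Real.sin (Real.pi / 3) / (Real.pi / 3)) ^ 2))⁻¹ + 1 : ℝ≥0∞) *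
        (haarProbability SU2 {U : SU2 | dist1 U < 1 / 3 + 1 / 21} ^ M / haarProbability SU2 {U : SU2 | dist1 U < 1 / 21}))
      ≤ 2 * ((300000000 : ℝ≥0∞) * (10 ^ 23 : ℝ≥0∞)⁻¹) := by gcongr; exacts [kstar_record_le, haar_window_ratio_le_numeral_of_le hM]
    _ ≤ ENNReal.ofReal (1 / 10 ^ 14) := by
        have hfin : (2 : ℝ≥0∞) * ((300000000 : ℝ≥0∞) * (10 ^ 23 : ℝ≥0∞)⁻¹) ≠ ⊤ :=
          ENNReal.mul_ne_top (by norm_num) (ENNReal.mul_ne_top (by norm_num) (ENNReal.inv_ne_top.2 (by positivity)))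
        rw [← ENNReal.toReal_le_toReal hfin ENNReal.ofReal_ne_top, ENNReal.toReal_ofReal (by norm_num : (0 : ℝ) ≤ 1 / 10 ^ 14),
          ENNReal.toReal_mul, ENNReal.toReal_mul, ENNReal.toReal_inv, ENNReal.toReal_pow]
        norm_num

/-- ★★ The same in the EXACT letters of a `…HTopSegment`-type engine over ✓`hw_su2_of_pow_le_four_hundred` at `P.d = 3`, `δ′ = 1/21`, with the block size
`L` SYMBOLIC (`4 ≤ L`; exponent `L ^ (3 − 1) − 1 ≥ 15`): `2·(K_rec·(Haar{dist1 < 1/3 + 1/21}^{L^{3−1} − 1} / Haar{dist1 < 1/21})) ≤ ofReal (10⁻¹⁴)`.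
[cite: Balaban1985UV3, p.260 (bookkeeping)] -/
theorem two_mul_kstar_record_mul_ratio_le_letters {L : ℕ} (hL4 : 4 ≤ L) :
    2 * ((((ENNReal.ofReal (((1 / 400 : ℝ) * Real.sin 1 * (Real.sin (Real.pi / 3) / (Real.pi / 3))) ^ 3 *
        (Real.sin (Real.pi / 3) / (Real.pi / 3)) ^ 2))⁻¹ + 1) *
        ((HaarData.haar : Measure (Matrix.specialUnitaryGroup (Fin 2) ℂ)) {g | dist1 g < 1 / 3 + 1 / 21} ^ (L ^ (3 - 1) - 1) /
          (HaarData.haar : Measure (Matrix.specialUnitaryGroup (Fin 2) ℂ)) {g | dist1 g < 1 / 21}))) ≤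
      ENNReal.ofReal (1 / 10 ^ 14) := by
  have h16 : 4 ^ (3 - 1) ≤ L ^ (3 - 1) := Nat.pow_le_pow_left hL4 _
  have hM : 15 ≤ L ^ (3 - 1) - 1 := by
    have : (4 : ℕ) ^ (3 - 1) = 16 := by norm_num
    omega
  rw [haarData_haar_eq]
  exact two_mul_kstar_record_mul_ratio_le_of_le hM


end Summit.QuantumFields.YangMills.Theorems.UV3BranchExpansionHaarBallSharpRecord

end
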